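import Summits.BirchSwinnertonDyer.BirchSwinnertonDyer.Theorems.GenusKolyvaginAtTwoGenusPrimitiveSupplyAtTwoTwistingPrime
import Summits.BirchSwinnertonDyer.BirchSwinnertonDyer.Theorems.GenusKolyvaginAtTwoGenusPrimitiveSupplyAtTwoTwistingPrimeLevelFourClass
import HarnessLib

/-!
# Route `GenusKolyvaginAtTwo`, crux K₄⁻ `K4Neg` (stmt-BirchSwinnertonDyer-31526), the phantom cell F4ᵖᵍ — THE HEEGNER DESCENT BIT,
# part 1: SUPPLY of prime Heegner frames at which the Lawson–Wuthrich class is ALIVE (Čebotarev, unconditionally), in GALOIS form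

Seat `bsd-line-gk2-p3` g34 (PROVER seat 3/3, cell `bsd-f1-sign2`), `--supports stmt-BirchSwinnertonDyer-31526 --as helper`.
THEOREMS ONLY (no definition, no named fact, no `sorry`); standard axioms; UNCONDITIONAL (Čebotarev is the tree theorem
`absoluteGaloisGroup.frobenius_dense` fed with `Automorphic.chebotarev_artinRep_holds`).  **BSD is NOT proved by this file; K4Neg
is NOT proved; nothing is closed.**

WHY.  LEAD gk2-p1 g28's `…K4NegPhantomCellTopBits` (p786172) reduces the K4Neg CONCLUSION SHAPE on the phantom cell F4ᵖᵍ (off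
the cut, not multiplicative at `2`) to one sharp Selmer class with good top bits (his supply, in progress) PLUS the Heegner descent
bit `hDesc`: «a multiple of `y_K` which is `2^M`-divisible by a point fixed by `Γ_{K(E[2^(M+2)])}` is `2^M`-divisible in `E(K)`».  On a
prime frame `K = ℚ(√−ℓ₀)` (`ℓ₀` a transposition prime, `#E(ℚ_{ℓ₀})[2] = 2`) `hDesc` reads «`loc_{ℓ₀} ξ_E ≠ 0`» for the level-`2`
Lawson–Wuthrich class `ξ_E ∈ H¹(ℚ, E[2])` (the unique non-zero class dying on `Γ_{ℚ(E[4])}`, gk2-p4 g10).  This file SUPPLIES such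
frames — `ξ_E` is an ordinary non-zero class of `H¹(ℚ, E[2])`, so gk2-p4 g7's Mazur–Rubin twisting primes at `2`
(`GenusKolyTwistingPrime.exists_twistingPrime`) apply to it — and EXPORTS the Galois datum its proof constructs, which is what the
descent bit consumes (sibling file `…PhantomCellDescentBitCore`): an arithmetic Frobenius `F` at a prime `𝔓 ∣ ℓ₀` acting on `E[2]` as
complex conjugation (a transposition), with `F·F ∈ Γ_{ℚ(E[2])}` and **`[x, F·F] ≠ 0`**.

* §1 `exists_twistingPrime_h1Eval_sq_ne_zero` — gk2-p4's `exists_twistingPrime` (VERBATIM proof) with the conclusion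
  `F * F ∈ torsionFixing W 2 ∧ h1Eval W 2 x (F * F) ≠ 0` added and the place exported as `primesEquiv v = ℓ`.
* §2 `exists_twistingPrime_h1Eval_sq_ne_zero_heegner` — the same in the line's currency: `ℓ ≡ 7 (mod 8)`, `p ∣ N → p ∣ ℓ + 1`,
  `ℓ ∤ 2N` (so `K = ℚ(√−ℓ)` is a prime Heegner field with `2` split, `d_K = −ℓ` odd `≠ −3`).
* §3 `exists_levelFour_phantom_twistingPrime` — specialised to the Lawson–Wuthrich class: for `ρ̄_{E,4}` onto and `Δ < 0`, a
  non-zero `ξ ∈ H¹(ℚ, E[2])` dying on `Γ_{ℚ(E[4])}` EXISTS and, beyond every bound, prime Heegner frames `ℓ` at which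
  `[ξ, F·F] ≠ 0` (hence `loc_ℓ ξ ≠ 0`): THE (α)-FRAMES of the phantom cell are in infinite supply.  On the complementary (β)-frames
  (`loc_{ℓ₀} ξ_E = 0`: the twin's Selmer generator IS the phantom) `hDesc` fails as stated — the honest residual of the road.

References: [MazurRubin2010] Prop. 3.3, Lemma 3.5 (twisting primes via Čebotarev); [GrossLMS1991] §9 Prop. 9.1, 9.6;
[McCallumLMS1991] §3; [LawsonWuthrich2016] §3 (Lemma 6, Thm. 1), §7.1; [SerreAbelianLadic1968] I §2.2.
-/

set_option linter.dupNamespace false -- tree convention: `Summit.BirchSwinnertonDyer.BirchSwinnertonDyer.Theorems` (summit = sub-problem)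
set_option autoImplicit false

noncomputable section

open scoped Classical Pointwise

namespace Summit.BirchSwinnertonDyer.BirchSwinnertonDyer.Theorems.GenusExact.PhantomDescentBit

open WeierstrassCurve NumberField IsDedekindDomain Field
open Literature.NumberTheory.GaloisRepresentations Literature.NumberTheory.EllipticCurves
open Literature.NumberTheory
open Summit.BirchSwinnertonDyer.BirchSwinnertonDyer.Theorems.GenusKolyTwistingPrime

/-! ## §1 Twisting primes with the Galois datum `[x, F·F] ≠ 0` exported -/

section Main

variable (W : WeierstrassCurve ℚ) [W.IsElliptic]

/-- **MAZUR–RUBIN TWISTING PRIMES AT `2`, GALOIS FORM.**  Let `E = W/ℚ` be elliptic with `Δ(W) < 0` and `ρ̄_{E,2}` onto, `c₀` a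
complex conjugation, `0 ≠ x ∈ H¹(ℚ, E[2])`, `m ≥ 1` and `b` a bound.  Then there is a prime `ℓ > b`, `ℓ ∤ m`, with `m ∣ ℓ + 1`, a place
`v` of `ℚ` with `primesEquiv v = ℓ`, a prime `𝔓 ∣ v` of `\bar ℤ` and an arithmetic Frobenius `F` at `𝔓` acting on `E[2]` as `c₀` (a
transposition), such that **`F·F ∈ Γ_{ℚ(E[2])}` and `[x, F·F] ≠ 0`**, and consequently `x_ℓ ≠ 0` in `H¹(ℚ_ℓ, E[2])`.  The proof is
gk2-p4 g7's `exists_twistingPrime` verbatim (key lemma `h₀ ∈ Γ_{ℚ(E[2],μ_m)}` with `c₀[x,h₀] ≠ [x,h₀]`; Čebotarev in the open set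
`c₀h₀·(𝒩_x ∩ Stab μ_m)`; `[x, F²] = c₀[x,h₀] + [x,h₀]`); only the bookkeeping of the conclusion differs (the Galois datum is kept).
[cite: MazurRubin2010, Prop. 3.3 and Lemma 3.5] [cite: GrossLMS1991, §9 Prop. 9.6] [cite: McCallumLMS1991, §3 Cor. 3.2] -/
theorem exists_twistingPrime_h1Eval_sq_ne_zero (hsurj : W.HasSurjectiveModNGaloisRep 2) (hΔ : W.Δ < 0)
    {c₀ : absoluteGaloisGroup ℚ} (hc₀ : IsComplexConjugation (Rat.castHom ℝ) c₀)
    {x : galH1Torsion W (2 : ℤ)} (hx : x ≠ 0) {m : ℕ} (hm : m ≠ 0) (b : ℕ) :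
    ∃ ℓ : ℕ, ∃ _ : Fact ℓ.Prime, b < ℓ ∧ ¬ ℓ ∣ m ∧ m ∣ ℓ + 1 ∧
      (∃ (v : HeightOneSpectrum (𝓞 ℚ)) (𝔓 : Ideal (absIntegers (𝓞 ℚ) ℚ))
          (F : absoluteGaloisGroup ℚ), (Rat.HeightOneSpectrum.primesEquiv (R := 𝓞 ℚ) v : ℕ) = ℓ ∧
          (ℓ : 𝓞 ℚ) ∈ v.asIdeal ∧ 𝔓 ∈ v.primesAbove ∧
          IsArithFrobAt (𝓞 ℚ) F 𝔓 ∧ (∀ P : geomTorsion W (2 : ℤ), F • P = c₀ • P) ∧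
          F * F ∈ torsionFixing W (2 : ℤ) ∧ h1Eval W (2 : ℤ) x (F * F) ≠ 0) ∧
      x ∉ W.torsionLocalKer ℚ_[ℓ] (2 : ℤ) := by
  classical
  haveI : NeZero m := ⟨hm⟩
  have hn0 : (2 : ℤ) ≠ 0 := two_ne_zero
  -- a primitive `m`-th root of unity in `ℚ̄`
  have hq0 : ((m : ℕ) : AlgebraicClosure ℚ) ≠ 0 := by exact_mod_cast hm
  haveI : NeZero ((m : ℕ) : AlgebraicClosure ℚ) := ⟨hq0⟩
  obtain ⟨ζ, hζ⟩ := IsAlgClosed.exists_root (Polynomial.cyclotomic m (AlgebraicClosure ℚ))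
    (Polynomial.degree_cyclotomic_pos m _ (Nat.pos_of_ne_zero hm)).ne'
  have hprim : IsPrimitiveRoot ζ m := Polynomial.isRoot_cyclotomic_iff.mp hζ
  -- ### the key lemma: `h₀ ∈ Γ_{ℚ(E[2])}` fixing `ζ` with `c₀ [x, h₀] ≠ [x, h₀]`
  obtain ⟨h₀, hh₀T, hh₀ζ, hh₀v⟩ := exists_torsionFixing_smul_h1Eval_ne W hsurj hΔ hc₀ hx hprim
  -- ### the finite exceptional set of places of `ℚ`
  set B : Finset ℕ := m.primeFactors ∪ Finset.range (b + 1) with hB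
  set S : Set (HeightOneSpectrum (𝓞 ℚ)) := {v | ∃ q ∈ B, q.Prime ∧ (q : 𝓞 ℚ) ∈ v.asIdeal}
    with hS
  have hSfin : S.Finite := by
    have : S ⊆ ⋃ q ∈ (B.filter Nat.Prime), {v | (q : 𝓞 ℚ) ∈ v.asIdeal} := by
      intro v ⟨q, hqB, hq, hqv⟩
      simp only [Set.mem_iUnion, Finset.mem_filter]
      exact ⟨q, ⟨hqB, hq⟩, hqv⟩
    refine Set.Finite.subset (Set.Finite.biUnion (Finset.finite_toSet _) fun q hq ↦ ?_) this
    rw [Finset.coe_filter, Set.mem_setOf_eq] at hq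
    have hsub : {v : HeightOneSpectrum (𝓞 ℚ) | (q : 𝓞 ℚ) ∈ v.asIdeal}.Subsingleton :=
      fun v hv v' hv' ↦ HeightOneSpectrum.eq_of_natCast_mem_rat hq.2 hv hv'
    exact hsub.finite
  -- ### Čebotarev: a Frobenius in the open set `c₀ h₀ · (𝒩 ∩ Stab ζ)`
  set 𝒩 := evalKer W (2 : ℤ) (fun _ : Unit ↦ x) with h𝒩
  have h𝒩open : IsOpen (𝒩 : Set (absoluteGaloisGroup ℚ)) :=
    isOpen_evalKer W _ _ (isOpen_torsionFixing W hn0)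
  set A : Subgroup (absoluteGaloisGroup ℚ) := MulAction.stabilizer (absoluteGaloisGroup ℚ) ζ with hA
  have hAopen : IsOpen (A : Set (absoluteGaloisGroup ℚ)) := by
    haveI : FiniteDimensional ℚ (IntermediateField.adjoin ℚ {ζ}) :=
      IntermediateField.adjoin.finiteDimensional
        ((AlgebraicClosure.isAlgebraic ℚ).isAlgebraic ζ).isIntegral
    refine Subgroup.isOpen_mono (H₁ := (IntermediateField.adjoin ℚ {ζ}).fixingSubgroup) ?_
      (IntermediateField.fixingSubgroup_isOpen _)
    intro σ hσ
    rw [IntermediateField.mem_fixingSubgroup_iff] at hσ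
    exact hσ ζ (IntermediateField.mem_adjoin_simple_self ℚ ζ)
  set U : Set (absoluteGaloisGroup ℚ) := (𝒩 : Set _) ∩ (A : Set _) with hU
  have hUopen : IsOpen U := h𝒩open.inter hAopen
  set O : Set (absoluteGaloisGroup ℚ) := (fun γ ↦ c₀ * h₀ * γ) '' U with hO
  have hOopen : IsOpen O := (Homeomorph.mulLeft (c₀ * h₀)).isOpenMap _ hUopen
  have hOne : O.Nonempty := ⟨c₀ * h₀ * 1, 1, ⟨𝒩.one_mem, A.one_mem⟩, rfl⟩
  obtain ⟨γ, hγO, v, hvS, 𝔓₀, h𝔓₀, hγ⟩ :=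
    (absoluteGaloisGroup.frobenius_dense Automorphic.chebotarev_artinRep_holds ℚ S hSfin
      ).inter_open_nonempty O hOopen hOne
  obtain ⟨u, ⟨hu𝒩, huA⟩, rfl⟩ := hγO
  have huT : u ∈ torsionFixing W (2 : ℤ) := hu𝒩.1
  have hux : h1Eval W (2 : ℤ) x u = 0 := hu𝒩.2 ()
  have huζ : u • ζ = ζ := huA
  set t := h₀ * u with ht
  have htT : t ∈ torsionFixing W (2 : ℤ) := mul_mem hh₀T huT
  have hγt : c₀ * h₀ * u = c₀ * t := by rw [ht, mul_assoc]
  -- ### the rational prime `ℓ` under `v` (Mathlib's generator of `v ∩ ℤ`) and `ℚ_v ≅ ℚ_ℓ`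
  set ℓ : ℕ := (Rat.HeightOneSpectrum.primesEquiv (R := 𝓞 ℚ) v : ℕ) with hℓdef
  have hℓ : ℓ.Prime := (Rat.HeightOneSpectrum.primesEquiv (R := 𝓞 ℚ) v).2
  haveI hℓF : Fact ℓ.Prime := ⟨hℓ⟩
  have hℓv : (ℓ : 𝓞 ℚ) ∈ v.asIdeal := by
    have h := (Rat.HeightOneSpectrum.natGenerator_dvd_iff (R := 𝓞 ℚ) v (n := ℓ)).mp dvd_rfl
    rw [Ideal.mem_map_iff_of_surjective _ (Rat.IsIntegralClosure.intEquiv (𝓞 ℚ)).surjective] at h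
    obtain ⟨y, hy, hyℓ⟩ := h
    have : y = (ℓ : 𝓞 ℚ) := (Rat.IsIntegralClosure.intEquiv (𝓞 ℚ)).injective (by rw [hyℓ, map_natCast])
    rwa [this] at hy
  haveI : CharZero (v.adicCompletion ℚ) :=
    charZero_of_injective_algebraMap (algebraMap ℚ (v.adicCompletion ℚ)).injective
  set θ : v.adicCompletion ℚ ≃+* ℚ_[ℓ] :=
    RingEquivClass.toRingEquiv (Rat.HeightOneSpectrum.adicCompletion.padicEquiv (R := 𝓞 ℚ) v)
    with hθ
  have hℓB : ℓ ∉ B := fun h ↦ hvS ⟨ℓ, h, hℓ, hℓv⟩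
  simp only [hB, Finset.mem_union, Nat.mem_primeFactors, Finset.mem_range, not_or] at hℓB
  obtain ⟨hℓm', hℓb⟩ := hℓB
  have hℓm : ¬ ℓ ∣ m := fun h ↦ hℓm' ⟨hℓ, h, hm⟩
  have hbℓ : b < ℓ := by omega
  -- ### `m ∣ ℓ + 1`: the Frobenius inverts `ζ` (as `c₀` does) and raises it to the `ℓ`-th power
  have hmv : (m : 𝓞 ℚ) ∉ v.asIdeal := natCast_not_mem_of_not_dvd hℓ hℓv hℓm
  have h1 : (c₀ * h₀ * u) • ζ = ζ⁻¹ := by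
    rw [mul_smul, mul_smul, huζ, hh₀ζ, RatClosure.smul_eq_inv_of_pow_eq_one hc₀ hm hprim.pow_eq_one]
  have h2 : (c₀ * h₀ * u) • ζ = ζ ^ v.residueCard :=
    smul_eq_pow_residueCard_of_isArithFrobAt_of_pow_eq_one hmv h𝔓₀ hγ hprim.pow_eq_one
  rw [residueCard_eq_of_natCast_mem_rat hℓ hℓv, h1] at h2
  have hζ0 : ζ ≠ 0 := hprim.ne_zero hm
  have hζ1 : ζ ^ (ℓ + 1) = 1 := by rw [pow_succ, ← h2, inv_mul_cancel₀ hζ0]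
  have hmdvd : m ∣ ℓ + 1 := (hprim.pow_eq_one_iff_dvd (ℓ + 1)).mp hζ1
  -- ### the Frobenius acts on `E[2]` as `c₀`
  have hFE : ∀ P : geomTorsion W (2 : ℤ), (c₀ * h₀ * u) • P = c₀ • P := fun P ↦ by
    rw [hγt, mul_smul, smul_eq_of_mem_torsionFixing W _ htT]
  -- ### `[x, γ²] = c₀ [x, h₀] + [x, h₀] ≠ 0`
  have hsq : c₀ * c₀ = 1 := by have h := hc₀.sq_eq_one; rwa [sq] at h
  have hcinv : c₀⁻¹ = c₀ := inv_eq_of_mul_eq_one_right hsq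
  have hγγ : (c₀ * h₀ * u) * (c₀ * h₀ * u) = (c₀ * t * c₀⁻¹) * t := by
    rw [hγt, hcinv]; group
  have hconjT : c₀ * t * c₀⁻¹ ∈ torsionFixing W (2 : ℤ) := (torsionFixing_normal W _).conj_mem t htT c₀
  have hγγT : (c₀ * h₀ * u) * (c₀ * h₀ * u) ∈ torsionFixing W (2 : ℤ) := by
    rw [hγγ]; exact mul_mem hconjT htT
  have hval : h1Eval W (2 : ℤ) x ((c₀ * h₀ * u) * (c₀ * h₀ * u)) ≠ 0 := by
    rw [hγγ, h1Eval_mul W _ x hconjT, h1Eval_conj W _ x c₀ htT, ht, h1Eval_mul W _ x hh₀T, hux,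
      add_zero]
    intro h0
    apply hh₀v
    have h2v : h1Eval W (2 : ℤ) x h₀ + h1Eval W (2 : ℤ) x h₀ = 0 := by
      rw [← two_nsmul]; exact AddSubgroup.torsionBy.nsmul _
    rw [eq_neg_of_add_eq_zero_left h0, neg_eq_of_add_eq_zero_left h2v]
  -- ### the local criterion at `v`, then transport to `ℚ_ℓ`
  have hloc := not_mem_torsionLocalKer_of_h1Eval_sq_ne_zero W (n := 2) two_ne_zero h𝔓₀ hγ hγγT hval
  refine ⟨ℓ, hℓF, hbℓ, hℓm, hmdvd, ⟨v, 𝔓₀, c₀ * h₀ * u, rfl, hℓv, h𝔓₀, hγ, hFE, hγγT, hval⟩,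
    fun hx' ↦ hloc ?_⟩
  exact (mem_torsionLocalKer_padic_iff W θ (2 : ℤ) x).mp hx'

end Main

/-! ## §2 The line's currency: prime Heegner frames `ℓ ≡ 7 (mod 8)`, `p ∣ N → p ∣ ℓ + 1` -/

section Heegner

variable (W : WeierstrassCurve ℚ) [W.IsElliptic]

/-- **Twisting primes for one class, Heegner-compatible, with the Galois datum.**  For `W/ℚ` elliptic with `Δ(W) < 0` and `ρ̄_{W,2}`
onto, a complex conjugation `c₀`, a non-zero class `x ∈ H¹(ℚ, E[2])`, any `N ≥ 1` and any bound `b`: a prime `ℓ > b` with `ℓ ∤ 2N`,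
`ℓ ≡ 7 (mod 8)`, `p ∣ ℓ + 1` for every `p ∣ N` (so `K = ℚ(√−ℓ)` is a prime Heegner field for level `N` with `2` split), a place `v`
(`primesEquiv v = ℓ`), a prime `𝔓 ∣ v` and an arithmetic Frobenius `F` at `𝔓` acting on `E[2]` as `c₀`, with `F·F ∈ Γ_{ℚ(E[2])}`,
**`[x, F·F] ≠ 0`**, and `x_ℓ ≠ 0`.  [cite: MazurRubin2010, Prop. 3.3 and Lemma 3.5] [cite: GrossLMS1991, §9 Prop. 9.6] -/
theorem exists_twistingPrime_h1Eval_sq_ne_zero_heegner (hsurj : W.HasSurjectiveModNGaloisRep 2) (hΔ : W.Δ < 0)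
    {c₀ : absoluteGaloisGroup ℚ} (hc₀ : IsComplexConjugation (Rat.castHom ℝ) c₀)
    {x : galH1Torsion W (2 : ℤ)} (hx : x ≠ 0) {N : ℕ} (hN : N ≠ 0) (b : ℕ) :
    ∃ ℓ : ℕ, ∃ _ : Fact ℓ.Prime, b < ℓ ∧ ¬ ℓ ∣ 2 * N ∧ ℓ % 8 = 7 ∧ (∀ p : ℕ, p ∣ N → p ∣ ℓ + 1) ∧
      (∃ (v : HeightOneSpectrum (𝓞 ℚ)) (𝔓 : Ideal (absIntegers (𝓞 ℚ) ℚ))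
          (F : absoluteGaloisGroup ℚ), (Rat.HeightOneSpectrum.primesEquiv (R := 𝓞 ℚ) v : ℕ) = ℓ ∧
          (ℓ : 𝓞 ℚ) ∈ v.asIdeal ∧ 𝔓 ∈ v.primesAbove ∧
          IsArithFrobAt (𝓞 ℚ) F 𝔓 ∧ (∀ P : geomTorsion W (2 : ℤ), F • P = c₀ • P) ∧
          F * F ∈ torsionFixing W (2 : ℤ) ∧ h1Eval W (2 : ℤ) x (F * F) ≠ 0) ∧
      x ∉ W.torsionLocalKer ℚ_[ℓ] (2 : ℤ) := by
  have hm : 8 * N ≠ 0 := by omega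
  obtain ⟨ℓ, hℓF, hbℓ, hℓm, hmdvd, hgal, hloc⟩ := exists_twistingPrime_h1Eval_sq_ne_zero W hsurj hΔ hc₀ hx hm b
  refine ⟨ℓ, hℓF, hbℓ, fun h ↦ hℓm (h.trans ⟨4, by ring⟩), ?_, fun p hp ↦ ?_, hgal, hloc⟩
  · have h8 : 8 ∣ ℓ + 1 := (Dvd.intro N rfl).trans hmdvd
    omega
  · exact (Dvd.dvd.mul_left hp 8).trans hmdvd

end Heegner

/-! ## §3 The Lawson–Wuthrich class has (α)-frames beyond every bound -/

section Phantom

variable (W : WeierstrassCurve ℚ) [W.IsElliptic]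

/-- **THE (α)-FRAMES OF THE PHANTOM CELL ARE IN INFINITE SUPPLY.**  For `W/ℚ` elliptic with `Δ(W) < 0` and `ρ̄_{E,4}` onto (so
`ρ̄_{E,2}` onto), the level-`4` Lawson–Wuthrich class exists — a NON-ZERO `ξ ∈ H¹(ℚ, E[2])` dying on `Γ_{ℚ(E[4])}` (gk2-p4 g10
`exists_ne_zero_forall_torsionFixing_four_h1Eval_eq_zero`; it is unique) — and for every `N ≥ 1` and every bound `b` there is a prime
`ℓ > b`, `ℓ ∤ 2N`, `ℓ ≡ 7 (mod 8)`, `p ∣ ℓ + 1` for all `p ∣ N` (a prime Heegner frame `K = ℚ(√−ℓ)` for level `N`, `2` split), with an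
arithmetic Frobenius `F` at a prime `𝔓 ∣ ℓ` acting on `E[2]` as complex conjugation, `F·F ∈ Γ_{ℚ(E[2])}` and **`[ξ, F·F] ≠ 0`**; in
particular `loc_ℓ ξ ≠ 0`.  These are exactly the frames on which the Heegner descent bit `hDesc` of the LEAD's road holds (sibling file);
the residual frames (`loc_ℓ ξ = 0`, i.e. `ξ` is the twin's Selmer generator) are where it fails as stated.  BSD is NOT proved by this.
[cite: LawsonWuthrich2016, §3 (Lemma 6, Thm. 1), §7.1] [cite: MazurRubin2010, Prop. 3.3 and Lemma 3.5] [cite: GrossLMS1991, §9 Prop. 9.6] -/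
theorem exists_levelFour_phantom_twistingPrime (hsurj4 : W.HasSurjectiveModNGaloisRep 4)
    (hsurj : W.HasSurjectiveModNGaloisRep 2) (hΔ : W.Δ < 0)
    {c₀ : absoluteGaloisGroup ℚ} (hc₀ : IsComplexConjugation (Rat.castHom ℝ) c₀) {N : ℕ} (hN : N ≠ 0) :
    ∃ ξ : galH1Torsion W (2 : ℤ), ξ ≠ 0 ∧ (∀ h ∈ torsionFixing W (4 : ℤ), h1Eval W (2 : ℤ) ξ h = 0) ∧
      ∀ b : ℕ, ∃ ℓ : ℕ, ∃ _ : Fact ℓ.Prime, b < ℓ ∧ ¬ ℓ ∣ 2 * N ∧ ℓ % 8 = 7 ∧ (∀ p : ℕ, p ∣ N → p ∣ ℓ + 1) ∧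
        (∃ (v : HeightOneSpectrum (𝓞 ℚ)) (𝔓 : Ideal (absIntegers (𝓞 ℚ) ℚ))
            (F : absoluteGaloisGroup ℚ), (Rat.HeightOneSpectrum.primesEquiv (R := 𝓞 ℚ) v : ℕ) = ℓ ∧
            (ℓ : 𝓞 ℚ) ∈ v.asIdeal ∧ 𝔓 ∈ v.primesAbove ∧
            IsArithFrobAt (𝓞 ℚ) F 𝔓 ∧ (∀ P : geomTorsion W (2 : ℤ), F • P = c₀ • P) ∧
            F * F ∈ torsionFixing W (2 : ℤ) ∧ h1Eval W (2 : ℤ) ξ (F * F) ≠ 0) ∧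
        ξ ∉ W.torsionLocalKer ℚ_[ℓ] (2 : ℤ) := by
  obtain ⟨ξ, hξ0, hξ⟩ := exists_ne_zero_forall_torsionFixing_four_h1Eval_eq_zero W hsurj4
  exact ⟨ξ, hξ0, hξ, fun b ↦ exists_twistingPrime_h1Eval_sq_ne_zero_heegner W hsurj hΔ hc₀ hξ0 hN b⟩

end Phantom

end Summit.BirchSwinnertonDyer.BirchSwinnertonDyer.Theorems.GenusExact.PhantomDescentBit

end
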